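import Summits.BirchSwinnertonDyer.BirchSwinnertonDyer.Theorems.GenusKolyvaginAtTwoEquivariantKolyvaginExactAtTwoVisiblePairFields
import Literature.NumberTheory.EllipticCurves.BSDRankZeroDensity
import HarnessLib

/-!
# Route `GenusKolyvaginAtTwo`, LINE 6, KEY crux Q3 (inner statement of stmt-BirchSwinnertonDyer-22137):
# THE INSTANCE at `2` over `ℚ` of gk2-p2's `KolyvaginDescent.VisiblePairHypothesesM` — `visiblePair I`
# (definition; reviewed)

Seat `bsd-line-gk2-p3` g12 (`--supports` the crux, closes nothing; kind definition). With the objects and displayed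
inputs of `…VisiblePairAtTwoDefs` and the derived axioms of `…VisiblePairAtTwoFields`, the record
`visiblePair I : VisiblePairHypothesesM (H¹(ℚ, E[2^M])) (H¹(ℚ, E^{(d_K)}[2^M])) (places of ℚ) (Γ_{K(E_K[2^M])} → E_K[2^M])`
is assembled field by field (`p = 2`; `torsion` by `zsmul_galH1Torsion_eq_zero`; `Sel = selmerGroup`; bookkeeping by
`…PairBookkeeping`); `visiblePair_Sel₁`, `visiblePair_Sel₂`, `visiblePair_data` identify its data by `rfl`, so that
gk2-p2's conclusions (`VisiblePairHypothesesM.pow_zsmul_sel₂_eq_zero_and_sel₁_le`,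
`sel₁_eq_and_card_sel₂_eq_of_primitive`, …) read on `Sel^{(2^M)}(E/ℚ)` and `Sel^{(2^M)}(E^{(d_K)}/ℚ)`; the
hypothesis-free ones are spelled out: `pow_zsmul_selmer_eq_zero_and_selmer_le` (Claims A/B = the exponent form of
Kolyvagin's Thm. `B_2` over `ℚ`), `selmer_twin_eq_bot_and_selmer_eq_of_M₀_eq_zero`, `exists_mem_selmer_twin_addOrderOf_eq`.
DEFINITION + `rfl` lemmas only; no instance, no notation, no named fact, no `sorry`. Nothing here is a claim about
BSD; the inputs `I` (Q2 over `K`, Lemma 4.3 over `ℚ` incl. the primes of `d_K`, (H2), visible Čebotarev, the classes)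
stay displayed.

References: [Kolyvagin1989Izv] §3 (the pair `(E, E^D)` over `ℚ`); [McCallumLMS1991] §3–§5; [GrossLMS1991] §3, §9, §10.
-/

set_option autoImplicit false
set_option linter.dupNamespace false -- tree convention: `Summit.BirchSwinnertonDyer.BirchSwinnertonDyer.Theorems` (summit = sub-problem)

noncomputable section

open scoped Classical

namespace Summit.BirchSwinnertonDyer.BirchSwinnertonDyer.Theorems.GenusExact.VisiblePairAtTwo

open WeierstrassCurve NumberField IsDedekindDomain Field Rat.HeightOneSpectrum
open Literature.NumberTheory.EllipticCurves Literature.NumberTheory.GaloisRepresentations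
open Literature.NumberTheory.EllipticCurves.KolyvaginDescent
open Summit.BirchSwinnertonDyer.BirchSwinnertonDyer.Theorems.GenusExact.FrobeniusCriterion
open Summit.BirchSwinnertonDyer.BirchSwinnertonDyer.Theorems.GenusExact.SelmerDescent
open Summit.BirchSwinnertonDyer.BirchSwinnertonDyer.Theorems.GenusExact.TwinGrossPrimes

/-! ## The instance -/

section Instance

variable {W : WeierstrassCurve ℚ} [W.IsElliptic] [W.IsGloballyMinimal] {K : Type} [Field K] [NumberField K]
  {M : ℕ} {θ : K} {hθ : θ ∉ Set.range (algebraMap ℚ K)}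
  {hθsq : θ ^ 2 = algebraMap ℚ K ((NumberField.discr K : ℤ) : ℚ)} [(twin W K).IsElliptic]

/-- **The visible pair data at `2` over `ℚ` for `(E, E^{(d_K)})`** — the instance of gk2-p2's
`KolyvaginDescent.VisiblePairHypothesesM` on `V₁ = H¹(ℚ, E[2^M])`, `V₂ = H¹(ℚ, E^{(d_K)}[2^M])`, places of `ℚ`,
`H = (Γ_{K(E_K[2^M])} → E_K[2^M])`, built from the displayed inputs `I` and this lineage's bricks (`duality`:
`…DualityRat` / `…TwinDualityRat`; `mem_loc_pl_iff`: `…SelmerConditionVisible`; `c_mem_loc_iff`: `…PropFourFourRat`;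
`torsion`: `zsmul_galH1Torsion_eq_zero`). [cite: Kolyvagin1989Izv, §3] [cite: McCallumLMS1991, §3–§5] -/
def visiblePair (I : Input W K M hθ hθsq) :
    VisiblePairHypothesesM (galH1Torsion W (lvl M)) (galH1Torsion (twin W K) (lvl M))
      (HeightOneSpectrum (𝓞 ℚ) ⊕ InfinitePlace ℚ) (HK W K M) where
  p := 2
  hp := Nat.prime_two
  M := M
  torsion₁ v := by
    have h : ((2 ^ M : ℕ) : ℤ) • v = 0 := zsmul_galH1Torsion_eq_zero W (lvl M) v
    rwa [Nat.cast_pow] at h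
  torsion₂ v := by
    have h : ((2 ^ M : ℕ) : ℤ) • v = 0 := zsmul_galH1Torsion_eq_zero (twin W K) (lvl M) v
    rwa [Nat.cast_pow] at h
  Sel₁ := selmerGroup W (lvl M)
  Sel₂ := selmerGroup (twin W K) (lvl M)
  Loc₁ := loc₁ W M
  Loc₂ := loc₂ W K M
  mem_sel_iff₁ s := by rw [mem_selmerGroup_iff, Sum.forall]; rfl
  mem_sel_iff₂ s := by rw [mem_selmerGroup_iff, Sum.forall]; rfl
  Kol := kolPrime W K M
  prime_of_kol _ h := h.1
  pl := pl
  Dv := Dv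
  dv_iff ℓ hℓK P := by
    obtain ⟨hℓ, -⟩ := hℓK
    rw [pl_of_prime hℓ]
    cases P with
    | inl v =>
      rw [Sum.inl.injEq]
      exact natCast_prime_mem_iff_eq hℓ v
    | inr w => exact ⟨fun h ↦ h.elim, fun h ↦ Sum.inr_ne_inl h⟩
  dv_mul ℓ ℓ' _ _ P h := by
    cases P with
    | inl v => exact natCast_mem_or_natCast_mem_of_mul_mem h
    | inr w => exact h.elim
  A₁ := a₁ W M
  A₂ := a₂ W K M
  x := I.x
  x_mem := I.x_mem
  x_ord := I.x_ord
  M₀ := I.M₀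
  c₁ := I.c₁
  c₂ := I.c₂
  c_one := I.c_one
  c_mem_loc₁ n hn hev P hP := by
    cases P with
    | inl v => exact I.loc_c₁_fin n hn hev v hP
    | inr w => exact I.loc_c₁_inf n hn hev w
  c_mem_loc₂ n hn hodd P hP := by
    cases P with
    | inl v => exact I.loc_c₂_fin n hn hodd v hP
    | inr w => exact I.loc_c₂_inf n hn hodd w
  c_mem_loc_iff₁₂ ℓ m hℓ hℓm hev a := c_mem_loc_iff₁₂_field I ℓ m hℓ hℓm hev a
  c_mem_loc_iff₂₁ ℓ m hℓ hℓm hodd a := c_mem_loc_iff₂₁_field I ℓ m hℓ hℓm hodd a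
  duality₁ ℓ hℓ d hd s hs a _ hda := duality₁_field I ℓ hℓ d hd s hs a hda
  duality₂ ℓ hℓ d hd s hs a _ hda := duality₂_field I ℓ hℓ d hd s hs a hda
  rK₁ := rK₁ W K M
  rK₂ := rK₂ W M hθ hθsq
  LocK := locK W K M
  mem_loc₁_pl_iff ℓ hℓ u := mem_loc₁_pl_iff_field I ℓ hℓ u
  mem_loc₂_pl_iff ℓ hℓ y := mem_loc₂_pl_iff_field I ℓ hℓ y
  sel_visible := I.sel_visible
  cebotarev := I.cebotarev

/-- The instance's `Sel₁` is `Sel^{(2^M)}(E/ℚ)`. [folklore] -/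
theorem visiblePair_Sel₁ (I : Input W K M hθ hθsq) : (visiblePair I).Sel₁ = selmerGroup W (lvl M) := rfl

/-- The instance's `Sel₂` is `Sel^{(2^M)}(E^{(d_K)}/ℚ)`. [folklore] -/
theorem visiblePair_Sel₂ (I : Input W K M hθ hθsq) :
    (visiblePair I).Sel₂ = selmerGroup (twin W K) (lvl M) := rfl

/-- The instance's `x`, `M`, `M₀`, `p`. [folklore] -/
theorem visiblePair_data (I : Input W K M hθ hθsq) :
    (visiblePair I).x = I.x ∧ (visiblePair I).M = M ∧ (visiblePair I).M₀ = I.M₀ ∧ (visiblePair I).p = 2 :=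
  ⟨rfl, rfl, rfl, rfl⟩

/-! ## The conclusions of the visible pair descent, read on the Selmer groups over `ℚ` -/

/-- **Claims A and B over `ℚ` for the pair `(E, E^{(d_K)})` at `2`, modulo the displayed inputs `I`**
(gk2-p2's `VisiblePairHypothesesM.pow_zsmul_sel₂_eq_zero_and_sel₁_le` on `visiblePair I`):
`2^{M₀} · Sel^{(2^M)}(E^{(d_K)}/ℚ) = 0` and `2^{2M₀} · Sel^{(2^M)}(E/ℚ) ⊆ ℤ x` — the exponent form of Kolyvagin's
Theorem `B_2` for visible pairs. CONDITIONAL on `I` (Q2 over `K`, Lemma 4.3 over `ℚ` at the finite places, (H2),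
visible Čebotarev, the classes); nothing about BSD is proved here. [cite: Kolyvagin1989Izv, §3 (Thm. B_l, l = 2)]
[cite: McCallumLMS1991, §1 Theorem and §5] -/
theorem pow_zsmul_selmer_eq_zero_and_selmer_le (I : Input W K M hθ hθsq) :
    (∀ s ∈ selmerGroup (twin W K) (lvl M), ((2 : ℤ) ^ I.M₀) • s = 0) ∧
      ∀ s ∈ selmerGroup W (lvl M), ∃ a : ℤ, ((2 : ℤ) ^ (2 * I.M₀)) • s = a • I.x :=
  (visiblePair I).pow_zsmul_sel₂_eq_zero_and_sel₁_le

/-- **`M₀ = 0` over `ℚ`**: if `c_M(1) = x` (the Heegner class is `2`-primitive at level `2^M`) then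
`Sel^{(2^M)}(E^{(d_K)}/ℚ) = 0` and `Sel^{(2^M)}(E/ℚ) = ℤ x`, modulo the inputs `I`
(`VisiblePairHypothesesM.sel₂_eq_bot_and_sel₁_eq_of_M₀_eq_zero`). [cite: Kolyvagin1989Izv, §3 (Thm. B_l, l = 2)]
[cite: GrossLMS1991, §10] -/
theorem selmer_twin_eq_bot_and_selmer_eq_of_M₀_eq_zero (I : Input W K M hθ hθsq) (h0 : I.M₀ = 0) :
    selmerGroup (twin W K) (lvl M) = ⊥ ∧ selmerGroup W (lvl M) = AddSubgroup.zmultiples I.x :=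
  (visiblePair I).sel₂_eq_bot_and_sel₁_eq_of_M₀_eq_zero h0

/-- **The lower-bound element over `ℚ`**: a Kolyvagin prime `ℓ` with `2^m ∥ c₂(ℓ)` in the sense
`2^{M−m−1} c₂(ℓ) ≠ 0 = 2^{M−m} c₂(ℓ)`, `m < M₀ ≤ M`, puts an element of order exactly `2^{M₀−m}` into
`Sel^{(2^M)}(E^{(d_K)}/ℚ)`, modulo the inputs `I` (`VisiblePairHypothesesM.exists_mem_sel₂_addOrderOf_eq`).
[cite: McCallumLMS1991, §5 Thm. 5.4 (proof)] -/
theorem exists_mem_selmer_twin_addOrderOf_eq (I : Input W K M hθ hθsq) (hM₀ : I.M₀ ≤ M) {m : ℕ}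
    (hm : m < I.M₀) {ℓ : ℕ} (hℓ : kolPrime W K M ℓ) (hc : ((2 : ℤ) ^ (M - m - 1)) • I.c₂ ℓ ≠ 0)
    (hc' : ((2 : ℤ) ^ (M - m)) • I.c₂ ℓ = 0) :
    ∃ t ∈ selmerGroup (twin W K) (lvl M), addOrderOf t = 2 ^ (I.M₀ - m) :=
  (visiblePair I).exists_mem_sel₂_addOrderOf_eq hM₀ hm hℓ hc hc'


end Instance

end Summit.BirchSwinnertonDyer.BirchSwinnertonDyer.Theorems.GenusExact.VisiblePairAtTwo

end
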